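/-
Copyright (c) 2026 the pub-hodgecm-mathlib formalisation cell (harness21).  Prover seat hodgecm-mathlib-K2Liu-p05 (g0): Track B «K2-LIT»,
#184♮ = hLiu418 = stmt-HodgeConjecture-24832; organ (R) «reduction to one-place slices» of socket #32d `sig_K2LiuDoublingHeightDecayLocal`
of `Cruxes/HLiu418/Lines/K2_Liu_CurveThetaSigs_U5d_ZetaS.lean` (ED. 1 a836627a4002dcd3 :224), file 2a; REPORT-FIRST K2/STATUS 2026-09-04.
-/
import Literature.NumberTheory.K2Lit.LocalDoublingZeta                                         -- ★ D7b: `placesEmbed ∕ placesEmbedFin ∕ splitPlaces_placesEmbedFin`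
import Literature.NumberTheory.K2Lit.LocalDoublingEmbedding                                    -- ★ D7a: `coe_iotaV ∕ iotaMatrix_map ∕ finPart_iotaV ∕ evalPlace_iotaVFin`
import Literature.NumberTheory.Automorphic.UnitaryGroupAdelicProduct                           -- ★ `archPart ∕ finPart ∕ adelicProdEquiv_symm_apply`
import Literature.NumberTheory.Automorphic.AdelicSimilitudeCongr                               -- ★ `toAdeleGL` (the values of `ιA`)
import HarnessLib

/-!
# Crux `HLiu418`, road `K2_Liu`, unit U5d, socket #32d — organ (R), file 2a: PLACE COMPONENTS OF `ι ∘ ιA ∘ placesEmbed`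

Cell `hodgecm-mathlib`, crux item hLiu418 = `stmt-HodgeConjecture-24832`; squad K2 ∕ K2Liu, LEAD F0P6-plan (g10), planner K2Liu-plan (g2), prover
K2Liu-p05 (g0).  THEOREMS ONLY (no `def` ∕ instance ∕ notation ∕ named-fact hypothesis ∕ `sorry`, default heartbeats); lane
`--supports stmt-HodgeConjecture-24832 --as helper` (count-neutral).  Bookkeeping for file 2b `K2LiuDoublingHeightDecayLocalOfSlices`:

* §1 `ι ∘ ιA` PRESERVES TRIVIAL PLACE COMPONENTS: `archPart_iotaLeft_eq_one`, `evalPlace_finPart_iotaLeft_eq_one` (`ι(y, 1)` is a block matrix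
  functorial in the coefficient ring — ★ `coe_iotaV`, ★ `iotaMatrix_map`, ★ `finPart_iotaV`, ★ `evalPlace_iotaVFin`), `archPart_iotaA_eq_one`,
  `evalPlace_finPart_iotaA_eq_one` (`ιA k = ĝ⁻¹ k ĝ` by the frame's `_hιA`, and ★ `GLn.toMixed`, `GLn.evalAt ∘ GLn.sndHom` are homomorphisms).
* §2 THE PLACE COMPONENTS OF ★ `placesEmbed S (a, y)`: archimedean part `a`, finite part `placesEmbedFin S y`, `w`-component `y_w` for `w ∈ S` and `1`
  off `S` (★ `splitPlaces_placesEmbedFin`); the peeling identity `y = (y with y_{v₀} := 1)·(y_{v₀} at v₀)` in `Π_{v∈S} G_v`.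

[BorelJacquet1979, §4.1: `G(𝔸) = G_∞ × G(𝔸_f)` and place components]; [HarrisKudlaSweet1996, §1 (1.11): the doubling embedding];
[PlatonovRapinchuk1994, §5.1: conjugate unitary groups]; [Liu2011, §2B p. 862: the `S`-splitting].  HONEST LABEL: count-neutral; `HC_CM` is proved only
modulo the 7 printed citations (2 remaining named inputs: hLiu418 = `stmt-HodgeConjecture-24832`, h413 = `stmt-HodgeConjecture-24833`) until rung 0 closes.
-/

set_option autoImplicit false
-- the mandated namespace repeats the single-problem summit's segment (`HodgeConjecture.HodgeConjecture`)
set_option linter.dupNamespace false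

noncomputable section

open scoped Matrix Kronecker
open NumberField IsDedekindDomain

namespace Summit.HodgeConjecture.HodgeConjecture.Cruxes.HLiu418.K2LiuDoublingEmbeddingPlaceComponents

open Literature.NumberTheory.Automorphic Literature.NumberTheory.Automorphic.UnitaryGroup
open Literature.NumberTheory.GelbartRogawski1991 Literature.NumberTheory.GelbartRogawski1991.GRConstruction
open Literature.NumberTheory.K2Lit.SiegelDoubled Literature.NumberTheory.K2Lit.PlaceSplitting

variable (L : Type) [Field L] [NumberField L] [IsCMField L]
variable {N M n : ℕ} (e : Fin N × Fin M ≃ Fin n)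
  (dV : Fin N → L) (hdV : ∀ i, IsCMField.complexConj L (dV i) = dV i)
  (dW : Fin M → L) (hdW : ∀ i, IsCMField.complexConj L (dW i) = dW i)

/-! ## §1 `ι` and `ιA` preserve trivial place components -/

omit [IsCMField L] in
/-- the block matrix of `ι(1, 1)` is `1` (★ `coe_iotaV`'s shape at `A = B = 1`). [cite: HarrisKudlaSweet1996, §1 (1.11)] -/
theorem iotaShape_one {R : Type} [CommRing R] :
    Matrix.reindex (e₂ (n := n)) (e₂ (n := n))
        (Matrix.fromBlocks (Matrix.reindex e e ((1 : Matrix (Fin N) (Fin N) R) ⊗ₖ (1 : Matrix (Fin M) (Fin M) R))) 0 0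
          (Matrix.reindex e e ((1 : Matrix (Fin N) (Fin N) R) ⊗ₖ (1 : Matrix (Fin M) (Fin M) R)))) = 1 := by
  simp only [Matrix.one_kronecker_one, Matrix.reindex_apply, Matrix.submatrix_one_equiv, Matrix.fromBlocks_one]

/-- **`ι(y, 1)_∞ = 1` if `y_∞ = 1`** (the archimedean part of the block matrix of `ι` is the block matrix of the archimedean parts).
[cite: BorelJacquet1979, §4.1] [cite: HarrisKudlaSweet1996, §1 (1.11)] -/
theorem archPart_iotaLeft_eq_one (y : UnitaryGroup.adelic (Fp L) L (IsCMField.complexConj L) N (Matrix.diagonal dV))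
    (hy : UnitaryGroup.archPart (Fp L) L (IsCMField.complexConj L) N (Matrix.diagonal dV) y = 1) :
    UnitaryGroup.archPart (Fp L) L (IsCMField.complexConj L) (n + n) (hermD L e dV hdV dW hdW) (iotaLeft L e dV hdV dW hdW y) = 1 := by
  -- `y_∞ = 1` as a statement about the `K_∞`-matrix of `y`
  have hy1 : GLn.fstHom N L ((y : UnitaryGroup.adelic (Fp L) L (IsCMField.complexConj L) N (Matrix.diagonal dV)) :
      GL (Fin N) (AdeleRing (𝓞 L) L)) = 1 := by
    have h := congrArg Subtype.val hy
    simp only [UnitaryGroup.coe_archPart, UnitaryGroup.adelicVal_apply, GLn.toMixed_apply, OneMemClass.coe_one] at h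
    exact (GLn.infiniteEquivMixed N L).injective (h.trans (map_one _).symm)
  have hy2 : (((y : UnitaryGroup.adelic (Fp L) L (IsCMField.complexConj L) N (Matrix.diagonal dV)) :
      GL (Fin N) (AdeleRing (𝓞 L) L)) : Matrix (Fin N) (Fin N) (AdeleRing (𝓞 L) L)).map (UnitaryGroup.adeleFst L) = 1 := by
    have h := congrArg (fun u : GL (Fin N) (InfiniteAdeleRing L) => (u : Matrix (Fin N) (Fin N) (InfiniteAdeleRing L))) hy1
    rw [Units.val_one] at h
    exact h
  -- the `K_∞`-matrix of `ι(y, 1)` is the block matrix of the `K_∞`-matrices, i.e. `1`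
  have hfst : GLn.fstHom (n + n) L ((iotaLeft L e dV hdV dW hdW y : HA L e dV hdV dW hdW) :
      GL (Fin (n + n)) (AdeleRing (𝓞 L) L)) = 1 := by
    refine Units.ext ?_
    rw [Units.val_one]
    change ((((iotaLeft L e dV hdV dW hdW y : HA L e dV hdV dW hdW) : GL (Fin (n + n)) (AdeleRing (𝓞 L) L)) :
        Matrix (Fin (n + n)) (Fin (n + n)) (AdeleRing (𝓞 L) L)).map (UnitaryGroup.adeleFst L)) = 1
    rw [iotaLeft_apply, coe_iotaV]
    dsimp only
    rw [iotaMatrix_map, hy2, OneMemClass.coe_one, Units.val_one, Matrix.map_one _ (map_zero _) (map_one _), iotaShape_one]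
  refine Subtype.ext ?_
  rw [UnitaryGroup.coe_archPart, UnitaryGroup.adelicVal_apply, GLn.toMixed_apply, hfst, map_one, OneMemClass.coe_one]

/-- **`ι(y, 1)_w = 1` if `y_w = 1`** (★ `finPart_iotaV`, ★ `evalPlace_iotaVFin`). [cite: Liu2011, §2C p. 863] [cite: HarrisKudlaSweet1996, §1 (1.11)] -/
theorem evalPlace_finPart_iotaLeft_eq_one (w : HeightOneSpectrum (𝓞 (Fp L)))
    (y : UnitaryGroup.adelic (Fp L) L (IsCMField.complexConj L) N (Matrix.diagonal dV))
    (hy : UnitaryGroup.evalPlace (Fp L) L (IsCMField.complexConj L) N (Matrix.diagonal dV) w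
      (UnitaryGroup.finPart (Fp L) L (IsCMField.complexConj L) N (Matrix.diagonal dV) y) = 1) :
    UnitaryGroup.evalPlace (Fp L) L (IsCMField.complexConj L) (n + n) (hermD L e dV hdV dW hdW) w
      (UnitaryGroup.finPart (Fp L) L (IsCMField.complexConj L) (n + n) (hermD L e dV hdV dW hdW) (iotaLeft L e dV hdV dW hdW y)) = 1 := by
  rw [iotaLeft_apply, finPart_iotaV, evalPlace_iotaVFin, hy]
  have h1 : UnitaryGroup.finPart (Fp L) L (IsCMField.complexConj L) N (Matrix.diagonal dV)
      (1 : UnitaryGroup.adelic (Fp L) L (IsCMField.complexConj L) N (Matrix.diagonal dV)) = 1 := map_one _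
  rw [h1, map_one, ← Prod.one_eq_mk, map_one]

section Bridge

variable {N' : ℕ} (H : Matrix (Fin N') (Fin N') L) (dV' : Fin N' → L) (g : GL (Fin N') L)
  (ιA : (UnitaryGroup.adelicGroupData (Fp L) L (IsCMField.complexConj L) N' H).Adelic →*
    UnitaryGroup.adelic (Fp L) L (IsCMField.complexConj L) N' (Matrix.diagonal dV'))
  (hιA : ∀ k, ((ιA k : ↥(UnitaryGroup.adelic (Fp L) L (IsCMField.complexConj L) N' (Matrix.diagonal dV'))) :
        GL (Fin N') (AdeleRing (𝓞 L) L)) =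
      (toAdeleGL L g)⁻¹ * UnitaryGroup.adelicVal (Fp L) L (IsCMField.complexConj L) N' H k * toAdeleGL L g)

include hιA in
/-- **`(ιA k)_∞ = 1` if `k_∞ = 1`** (`ιA k = ĝ⁻¹ k ĝ` and ★ `GLn.toMixed` is a homomorphism). [cite: PlatonovRapinchuk1994, §5.1] [cite: BorelJacquet1979, §4.1] -/
theorem archPart_iotaA_eq_one (k : (UnitaryGroup.adelicGroupData (Fp L) L (IsCMField.complexConj L) N' H).Adelic)
    (hk : UnitaryGroup.archPart (Fp L) L (IsCMField.complexConj L) N' H k = 1) :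
    UnitaryGroup.archPart (Fp L) L (IsCMField.complexConj L) N' (Matrix.diagonal dV') (ιA k) = 1 := by
  have h := congrArg Subtype.val hk
  simp only [UnitaryGroup.coe_archPart, OneMemClass.coe_one] at h
  refine Subtype.ext ?_
  rw [UnitaryGroup.coe_archPart, UnitaryGroup.adelicVal_apply, hιA k, map_mul, map_mul, map_inv, h, mul_one, inv_mul_cancel,
    OneMemClass.coe_one]

include hιA in
/-- **`(ιA k)_w = 1` if `k_w = 1`** (`ιA k = ĝ⁻¹ k ĝ` and ★ `GLn.evalAt w' ∘ GLn.sndHom` is a homomorphism, for every `w' ∣ w`).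
[cite: PlatonovRapinchuk1994, §5.1] [cite: BorelJacquet1979, §4.1] -/
theorem evalPlace_finPart_iotaA_eq_one (w : HeightOneSpectrum (𝓞 (Fp L)))
    (k : (UnitaryGroup.adelicGroupData (Fp L) L (IsCMField.complexConj L) N' H).Adelic)
    (hk : UnitaryGroup.evalPlace (Fp L) L (IsCMField.complexConj L) N' H w
      (UnitaryGroup.finPart (Fp L) L (IsCMField.complexConj L) N' H k) = 1) :
    UnitaryGroup.evalPlace (Fp L) L (IsCMField.complexConj L) N' (Matrix.diagonal dV') w
      (UnitaryGroup.finPart (Fp L) L (IsCMField.complexConj L) N' (Matrix.diagonal dV') (ιA k)) = 1 := by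
  refine Subtype.ext (funext fun w' => ?_)
  have h := congrArg (fun u : UnitaryGroup.localPi L (IsCMField.complexConj L) N' H w =>
    ((u : UnitaryGroup.LocalGLPi L N' w) w')) hk
  simp only [UnitaryGroup.coe_evalPlace_apply, UnitaryGroup.coe_finPart, OneMemClass.coe_one, Pi.one_apply] at h
  rw [UnitaryGroup.coe_evalPlace_apply, UnitaryGroup.coe_finPart, UnitaryGroup.adelicVal_apply, hιA k]
  simp only [map_mul, map_inv]
  rw [h, mul_one, inv_mul_cancel, OneMemClass.coe_one, Pi.one_apply]

end Bridge

/-! ## §2 The place components of `placesEmbed S (a, y)` -/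

section Embed

variable {N' : ℕ} (H : Matrix (Fin N') (Fin N') L)
  (S : Finset (HeightOneSpectrum (𝓞 (Fp L)))) [DecidableEq (HeightOneSpectrum (𝓞 (Fp L)))]

/-- `(placesEmbed S (a, y))_∞ = a`. [cite: BorelJacquet1979, §4.1] [cite: Liu2011, §2B p. 862] -/
theorem archPart_placesEmbed (a : UnitaryGroup.arch (Fp L) L (IsCMField.complexConj L) N' H)
    (y : Π v : S, UnitaryGroup.localPi L (IsCMField.complexConj L) N' H v.1) :
    UnitaryGroup.archPart (Fp L) L (IsCMField.complexConj L) N' H (placesEmbed L H S (a, y)) = a := by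
  rw [placesEmbed_apply, UnitaryGroup.adelicProdEquiv_symm_apply, map_mul, UnitaryGroup.archPart_archToAdelic,
    UnitaryGroup.archPart_finAdelicToAdelic, mul_one]

/-- `(placesEmbed S (a, y))_f = placesEmbedFin S y`. [cite: BorelJacquet1979, §4.1] [cite: Liu2011, §2B p. 862] -/
theorem finPart_placesEmbed (a : UnitaryGroup.arch (Fp L) L (IsCMField.complexConj L) N' H)
    (y : Π v : S, UnitaryGroup.localPi L (IsCMField.complexConj L) N' H v.1) :
    UnitaryGroup.finPart (Fp L) L (IsCMField.complexConj L) N' H (placesEmbed L H S (a, y)) = placesEmbedFin L H S y := by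
  rw [placesEmbed_apply, UnitaryGroup.adelicProdEquiv_symm_apply, map_mul, UnitaryGroup.finPart_archToAdelic,
    UnitaryGroup.finPart_finAdelicToAdelic, one_mul]

/-- `(placesEmbedFin S y)_w = y_w` for `w ∈ S`. [cite: Liu2011, §2B p. 862] -/
theorem evalPlace_placesEmbedFin_of_mem (y : Π v : S, UnitaryGroup.localPi L (IsCMField.complexConj L) N' H v.1)
    (w : HeightOneSpectrum (𝓞 (Fp L))) (hw : w ∈ S) :
    UnitaryGroup.evalPlace (Fp L) L (IsCMField.complexConj L) N' H w (placesEmbedFin L H S y) = y ⟨w, hw⟩ := by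
  have h := splitPlaces_fst_apply (Fp L) L (IsCMField.complexConj L) N' H S (placesEmbedFin L H S y) ⟨w, hw⟩
  rw [splitPlaces_placesEmbedFin] at h
  exact h.symm

/-- `(placesEmbedFin S y)_w = 1` for `w ∉ S`. [cite: Liu2011, §2B p. 862] -/
theorem evalPlace_placesEmbedFin_of_not_mem (y : Π v : S, UnitaryGroup.localPi L (IsCMField.complexConj L) N' H v.1)
    (w : HeightOneSpectrum (𝓞 (Fp L))) (hw : w ∉ S) :
    UnitaryGroup.evalPlace (Fp L) L (IsCMField.complexConj L) N' H w (placesEmbedFin L H S y) = 1 := by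
  have h := splitPlaces_snd_apply (Fp L) L (IsCMField.complexConj L) N' H S (placesEmbedFin L H S y) ⟨w, hw⟩
  rw [splitPlaces_placesEmbedFin] at h
  exact h.symm

/-- peeling one coordinate: `y = (y with y_{v₀} := 1) · (y_{v₀} at v₀)` in `Π_{v∈S} G_v`. [cite: BorelJacquet1979, §4.1] -/
theorem update_mul_mulSingle (y : Π v : S, UnitaryGroup.localPi L (IsCMField.complexConj L) N' H v.1) (v₀ : S) :
    Function.update y v₀ 1 * Pi.mulSingle v₀ (y v₀) = y := by
  funext v
  rw [Pi.mul_apply]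
  rcases eq_or_ne v v₀ with rfl | hv
  · rw [Function.update_self, Pi.mulSingle_eq_same, one_mul]
  · rw [Function.update_of_ne hv, Pi.mulSingle_eq_of_ne hv, mul_one]

end Embed

end Summit.HodgeConjecture.HodgeConjecture.Cruxes.HLiu418.K2LiuDoublingEmbeddingPlaceComponents

end
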